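import Summits.Ventures.HodgeRepro2.T5InertIwasawaRow

/-!
# Towards the Iwasawa decomposition of `U(2,1)` at an inert place, part 2: every `g` has a `K`-translate with
bottom row `(0, 0, r)`
(cell pub-hodge-repro2, seat p3)

Tier-5 N3 support. The bottom row `(p, q, r)` of `g ∈ U(J₃(u))` is a non-zero isotropic vector. Scaled by a
suitable `λ ∈ Eˣ` it becomes integral with a unit entry (`exists_scale_primitive`, the `ϖ`-adic valuation of
Mathlib's `IsDiscreteValuationRing.addVal`); the isotropy then forces `p` or `r` to be a unit
(`isUnit_fst_or_isUnit_last`: otherwise `q q̄ / u ∈ ϖ R`, so `q` is not a unit either); and file 218's clearing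
lemma — after the Weyl swap when the unit is `p` — produces `κ ∈ K` with `g κ` of bottom row `(0, 0, r')`,
`r' ≠ 0` (**`exists_mem_hyperspecial_coe_mul_eq`**).

Mathlib + this seat's file 218 and its imports; no display; no device.
§8(d): uses an L-value-free non-vanishing device: NO.
-/

namespace Summit.Ventures.HodgeRepro2.T5InertIwasawaPrimitive

open Matrix
open Summit.Ventures.HodgeRepro2.T5CartanCellsDistinct Summit.Ventures.HodgeRepro2.T5HermitianThreeElements
  Summit.Ventures.HodgeRepro2.T5UnitaryGroupForm Summit.Ventures.HodgeRepro2.T5UnitaryHeckeAdjoint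
  Summit.Ventures.HodgeRepro2.T5UnitaryThreeCorner Summit.Ventures.HodgeRepro2.T5InertIwasawaRow

/-! ## Scaling a vector to a primitive integral one -/

section Scale

variable {R E : Type*} [CommRing R] [IsDomain R] [IsDiscreteValuationRing R] [Field E] [Algebra R E]
  [IsFractionRing R E] {ϖ : R} (hϖ : Irreducible ϖ)

/-- A common denominator for three elements of the fraction field. -/
theorem exists_common_denominator (p q r : E) :
    ∃ s : R, s ≠ 0 ∧ IsLocalization.IsInteger R (algebraMap R E s * p) ∧
      IsLocalization.IsInteger R (algebraMap R E s * q) ∧ IsLocalization.IsInteger R (algebraMap R E s * r) := by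
  obtain ⟨xp, yp, hyp, hp⟩ := IsFractionRing.div_surjective R p
  obtain ⟨xq, yq, hyq, hq⟩ := IsFractionRing.div_surjective R q
  obtain ⟨xr, yr, hyr, hr⟩ := IsFractionRing.div_surjective R r
  have hyp0 : algebraMap R E yp ≠ 0 :=
    (map_ne_zero_iff _ (IsFractionRing.injective R E)).2 (nonZeroDivisors.ne_zero hyp)
  have hyq0 : algebraMap R E yq ≠ 0 :=
    (map_ne_zero_iff _ (IsFractionRing.injective R E)).2 (nonZeroDivisors.ne_zero hyq)
  have hyr0 : algebraMap R E yr ≠ 0 :=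
    (map_ne_zero_iff _ (IsFractionRing.injective R E)).2 (nonZeroDivisors.ne_zero hyr)
  refine ⟨yp * yq * yr, mul_ne_zero (mul_ne_zero (nonZeroDivisors.ne_zero hyp) (nonZeroDivisors.ne_zero hyq))
    (nonZeroDivisors.ne_zero hyr), ⟨xp * yq * yr, ?_⟩, ⟨xq * yp * yr, ?_⟩, ⟨xr * yp * yq, ?_⟩⟩
  · rw [← hp]; simp only [map_mul]; field_simp
  · rw [← hq]; simp only [map_mul]; field_simp
  · rw [← hr]; simp only [map_mul]; field_simp

omit [IsDomain R] [IsDiscreteValuationRing R] in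
include hϖ in
/-- `r / ϖ^m` is integral when `ϖ^m ∣ r`. -/
theorem isInteger_div_pow_of_dvd {r : R} {m : ℕ} (h : ϖ ^ m ∣ r) :
    IsLocalization.IsInteger R (algebraMap R E r / algebraMap R E ϖ ^ m) := by
  obtain ⟨t, rfl⟩ := h
  have hϖ0 : algebraMap R E ϖ ≠ 0 := (map_ne_zero_iff _ (IsFractionRing.injective R E)).2 hϖ.ne_zero
  refine ⟨t, ?_⟩
  rw [map_mul, map_pow]
  field_simp

include hϖ in
/-- The valuation of `ϖ^m` is `m`. -/
theorem addVal_pow_uniformiser (m : ℕ) : IsDiscreteValuationRing.addVal R (ϖ ^ m) = m := by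
  rw [IsDiscreteValuationRing.addVal_pow, IsDiscreteValuationRing.addVal_uniformizer hϖ, nsmul_eq_mul, mul_one]

include hϖ in
/-- An element of valuation `m` divided by `ϖ^m` is a unit (integral inverse, non-zero). -/
theorem isInteger_inv_div_pow_of_addVal_eq {r : R} {m : ℕ} (h : IsDiscreteValuationRing.addVal R r = m) :
    IsLocalization.IsInteger R (algebraMap R E r / algebraMap R E ϖ ^ m)⁻¹ ∧
      algebraMap R E r / algebraMap R E ϖ ^ m ≠ 0 := by
  have hr0 : r ≠ 0 := by
    intro hr0
    rw [hr0, IsDiscreteValuationRing.addVal_eq_top_iff.2 rfl] at h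
    exact ENat.coe_ne_top m h.symm
  obtain ⟨n, v, rfl⟩ := IsDiscreteValuationRing.eq_unit_mul_pow_irreducible hr0 hϖ
  have hn : n = m := by
    have := IsDiscreteValuationRing.addVal_def ((v : R) * ϖ ^ n) v hϖ n rfl
    rw [this] at h
    exact_mod_cast h
  rw [← hn]
  have hϖ0 : algebraMap R E ϖ ≠ 0 := (map_ne_zero_iff _ (IsFractionRing.injective R E)).2 hϖ.ne_zero
  have hdiv : algebraMap R E ((v : R) * ϖ ^ n) / algebraMap R E ϖ ^ n = algebraMap R E (v : R) := by
    rw [map_mul, map_pow, mul_div_assoc, div_self (pow_ne_zero _ hϖ0), mul_one]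
  rw [hdiv]
  exact ⟨⟨((v⁻¹ : Rˣ) : R), map_units_inv _ _⟩,
    (map_ne_zero_iff _ (IsFractionRing.injective R E)).2 v.ne_zero⟩

include hϖ in
/-- **Primitive scaling**: a non-zero triple has a non-zero multiple which is integral with a unit entry. -/
theorem exists_scale_primitive (p q r : E) (h : ¬ (p = 0 ∧ q = 0 ∧ r = 0)) :
    ∃ l : E, l ≠ 0 ∧ IsLocalization.IsInteger R (l * p) ∧ IsLocalization.IsInteger R (l * q) ∧
      IsLocalization.IsInteger R (l * r) ∧
      ((IsLocalization.IsInteger R (l * p)⁻¹ ∧ l * p ≠ 0) ∨ (IsLocalization.IsInteger R (l * q)⁻¹ ∧ l * q ≠ 0) ∨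
        (IsLocalization.IsInteger R (l * r)⁻¹ ∧ l * r ≠ 0)) := by
  obtain ⟨s, hs0, ⟨ap, hap⟩, ⟨aq, haq⟩, ⟨ar, har⟩⟩ := exists_common_denominator (R := R) p q r
  have hs0' : algebraMap R E s ≠ 0 := (map_ne_zero_iff _ (IsFractionRing.injective R E)).2 hs0
  have hϖ0 : algebraMap R E ϖ ≠ 0 := (map_ne_zero_iff _ (IsFractionRing.injective R E)).2 hϖ.ne_zero
  -- the three valuations; their minimum is finite
  set vp := IsDiscreteValuationRing.addVal R ap with hvp
  set vq := IsDiscreteValuationRing.addVal R aq with hvq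
  set vr := IsDiscreteValuationRing.addVal R ar with hvr
  have hmin : min vp (min vq vr) ≠ ⊤ := by
    intro htop
    rw [min_eq_top, min_eq_top, hvp, hvq, hvr, IsDiscreteValuationRing.addVal_eq_top_iff,
      IsDiscreteValuationRing.addVal_eq_top_iff, IsDiscreteValuationRing.addVal_eq_top_iff] at htop
    obtain ⟨hp0, hq0, hr0⟩ := htop
    subst hp0 hq0 hr0
    rw [map_zero] at hap haq har
    refine h ⟨?_, ?_, ?_⟩
    · exact (mul_eq_zero.1 hap.symm).resolve_left hs0'
    · exact (mul_eq_zero.1 haq.symm).resolve_left hs0'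
    · exact (mul_eq_zero.1 har.symm).resolve_left hs0'
  obtain ⟨m, hm⟩ := ENat.ne_top_iff_exists.1 hmin
  -- `l = s ϖ^{−m}`
  refine ⟨algebraMap R E s / algebraMap R E ϖ ^ m, div_ne_zero hs0' (pow_ne_zero _ hϖ0), ?_, ?_, ?_, ?_⟩
  · rw [div_mul_eq_mul_div, ← hap]
    exact isInteger_div_pow_of_dvd hϖ (IsDiscreteValuationRing.addVal_le_iff_dvd.1
      (by rw [addVal_pow_uniformiser hϖ, hm]; exact min_le_left _ _))
  · rw [div_mul_eq_mul_div, ← haq]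
    exact isInteger_div_pow_of_dvd hϖ (IsDiscreteValuationRing.addVal_le_iff_dvd.1
      (by rw [addVal_pow_uniformiser hϖ, hm]; exact (min_le_right _ _).trans (min_le_left _ _)))
  · rw [div_mul_eq_mul_div, ← har]
    exact isInteger_div_pow_of_dvd hϖ (IsDiscreteValuationRing.addVal_le_iff_dvd.1
      (by rw [addVal_pow_uniformiser hϖ, hm]; exact (min_le_right _ _).trans (min_le_right _ _)))
  · rcases min_choice vp (min vq vr) with h1 | h1
    · left
      rw [div_mul_eq_mul_div, ← hap]
      exact ⟨(isInteger_inv_div_pow_of_addVal_eq hϖ (by rw [← hvp, ← h1, ← hm])).1,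
        (isInteger_inv_div_pow_of_addVal_eq hϖ (by rw [← hvp, ← h1, ← hm])).2⟩
    · rcases min_choice vq vr with h2 | h2
      · right; left
        rw [div_mul_eq_mul_div, ← haq]
        exact ⟨(isInteger_inv_div_pow_of_addVal_eq hϖ (by rw [← hvq, ← h2, ← h1, ← hm])).1,
          (isInteger_inv_div_pow_of_addVal_eq hϖ (by rw [← hvq, ← h2, ← h1, ← hm])).2⟩
      · right; right
        rw [div_mul_eq_mul_div, ← har]
        exact ⟨(isInteger_inv_div_pow_of_addVal_eq hϖ (by rw [← hvr, ← h2, ← h1, ← hm])).1,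
          (isInteger_inv_div_pow_of_addVal_eq hϖ (by rw [← hvr, ← h2, ← h1, ← hm])).2⟩

include hϖ in
/-- An integral element is a unit or divisible by `ϖ`. -/
theorem isInteger_inv_or_isInteger_div {x : E} (hx : IsLocalization.IsInteger R x) :
    IsLocalization.IsInteger R x⁻¹ ∨ IsLocalization.IsInteger R (x / algebraMap R E ϖ) := by
  obtain ⟨r, rfl⟩ := hx
  by_cases hr : IsUnit r
  · left
    exact ⟨((hr.unit⁻¹ : Rˣ) : R), by rw [map_units_inv]; rfl⟩
  · right
    have hr' : r ∈ IsLocalRing.maximalIdeal R := (IsLocalRing.mem_maximalIdeal r).2 (mem_nonunits_iff.2 hr)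
    rw [hϖ.maximalIdeal_eq, Ideal.mem_span_singleton] at hr'
    obtain ⟨t, rfl⟩ := hr'
    have hϖ0 : algebraMap R E ϖ ≠ 0 := (map_ne_zero_iff _ (IsFractionRing.injective R E)).2 hϖ.ne_zero
    exact ⟨t, by rw [map_mul]; field_simp⟩

end Scale

/-! ## The dichotomy: a primitive isotropic vector has a unit first or last entry -/

section Dichotomy

variable {R E : Type*} [CommRing R] [IsDomain R] [IsDiscreteValuationRing R] [Field E] [StarRing E]
  [Algebra R E] [IsFractionRing R E]
  (hstar : ∀ x : E, IsLocalization.IsInteger R x → IsLocalization.IsInteger R (star x))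
  (u : E) (hu : IsLocalization.IsInteger R u) {ϖ : R} (hϖ : Irreducible ϖ)

include hstar hu hϖ in
/-- **For an integral isotropic vector `(p, q, r)` with a unit entry, `p` or `r` is a unit**: if neither is,
`q q̄ / u = −(r p̄ + p r̄) ∈ ϖ R`, so `q` is not a unit either. -/
theorem isUnit_fst_or_isUnit_last (hu0 : u ≠ 0) {p q r : E} (hp : IsLocalization.IsInteger R p)
    (hr : IsLocalization.IsInteger R r)
    (hrel : r * star p + q * u⁻¹ * star q + p * star r = 0)
    (hprim : (IsLocalization.IsInteger R p⁻¹ ∧ p ≠ 0) ∨ (IsLocalization.IsInteger R q⁻¹ ∧ q ≠ 0) ∨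
      (IsLocalization.IsInteger R r⁻¹ ∧ r ≠ 0)) :
    (IsLocalization.IsInteger R p⁻¹ ∧ p ≠ 0) ∨ (IsLocalization.IsInteger R r⁻¹ ∧ r ≠ 0) := by
  by_contra hcon
  rw [not_or] at hcon
  rcases hprim with h | h | h
  · exact hcon.1 h
  · -- `q` is a unit; then `ϖ⁻¹ = (q q̄)⁻¹ · (q q̄ / ϖ)` would be integral
    have hϖ0 : algebraMap R E ϖ ≠ 0 := (map_ne_zero_iff _ (IsFractionRing.injective R E)).2 hϖ.ne_zero
    have hp' : IsLocalization.IsInteger R (p / algebraMap R E ϖ) := by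
      rcases isInteger_inv_or_isInteger_div hϖ hp with h' | h'
      · by_cases hp0 : p = 0
        · exact ⟨0, by rw [hp0, map_zero, zero_div]⟩
        · exact absurd ⟨h', hp0⟩ hcon.1
      · exact h'
    have hr' : IsLocalization.IsInteger R (r / algebraMap R E ϖ) := by
      rcases isInteger_inv_or_isInteger_div hϖ hr with h' | h'
      · by_cases hr0 : r = 0
        · exact ⟨0, by rw [hr0, map_zero, zero_div]⟩
        · exact absurd ⟨h', hr0⟩ hcon.2
      · exact h'
    have h2 : q * star q = -(u * (r * star p + p * star r)) := by
      have h3 : q * u⁻¹ * star q = -(r * star p + p * star r) := by linear_combination hrel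
      calc q * star q = u * (q * u⁻¹ * star q) := by field_simp
        _ = -(u * (r * star p + p * star r)) := by rw [h3]; ring
    have hqq : IsLocalization.IsInteger R (q * star q / algebraMap R E ϖ) := by
      have : q * star q / algebraMap R E ϖ =
          -(u * ((r / algebraMap R E ϖ) * star p + (p / algebraMap R E ϖ) * star r)) := by
        rw [h2]; field_simp; try ring
      rw [this]
      exact isInteger_neg (IsLocalization.isInteger_mul hu (IsLocalization.isInteger_add
        (IsLocalization.isInteger_mul hr' (hstar _ hp)) (IsLocalization.isInteger_mul hp' (hstar _ hr))))
    have hq0 : star q ≠ 0 := star_ne_zero.2 h.2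
    have hinv : IsLocalization.IsInteger R (algebraMap R E ϖ)⁻¹ := by
      have key : q⁻¹ * (star q)⁻¹ * (q * star q / algebraMap R E ϖ) = (algebraMap R E ϖ)⁻¹ := by
        field_simp
        rw [div_self h.2]
      rw [← key]
      exact IsLocalization.isInteger_mul (IsLocalization.isInteger_mul h.1 (isInteger_star_inv hstar h.1)) hqq
    have := (isInteger_zpow_iff (E := E) hϖ (-1)).1 (by rwa [_root_.zpow_neg_one])
    omega
  · exact hcon.2 h

end Dichotomy

/-! ## Every `g` has a `K`-translate with bottom row `(0, 0, r)` -/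

section Translate

variable {R E : Type*} [CommRing R] [IsDomain R] [IsDiscreteValuationRing R] [Field E] [StarRing E]
  [Algebra R E] [IsFractionRing R E]
  (hstar : ∀ x : E, IsLocalization.IsInteger R x → IsLocalization.IsInteger R (star x))
  (u : E) (hsu : star u = u) (hu0 : u ≠ 0) (hu : IsLocalization.IsInteger R u)
  (hu' : IsLocalization.IsInteger R u⁻¹) {ϖ : R} (hϖ : Irreducible ϖ)

omit [Field E] [StarRing E] in
/-- Every `3 × 3` matrix is `!![…]` of its entries. -/
theorem eq_fin_three (M : Matrix (Fin 3) (Fin 3) E) :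
    M = !![M 0 0, M 0 1, M 0 2; M 1 0, M 1 1, M 1 2; M 2 0, M 2 1, M 2 2] := by
  ext i j
  fin_cases i <;> fin_cases j <;> rfl

omit [IsDomain R] [IsDiscreteValuationRing R] in
include hstar hsu hu0 hu' in
/-- **The case of a unit last entry**: if the bottom row `(p, q, r)` of `g` becomes, after the scaling `l`,
integral with `l r` a unit, then one lower unipotent `κ ∈ K` clears it to `(0, 0, r)`. -/
theorem exists_mem_hyperspecial_of_unit_last (g : formUnitaryGroup (J3 u)) (a b c d e f p q r : E)
    (hg : ((g : GL (Fin 3) E) : Matrix (Fin 3) (Fin 3) E) = !![a, b, c; d, e, f; p, q, r]) {l : E} (hl0 : l ≠ 0)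
    (hlp : IsLocalization.IsInteger R (l * p)) (hlq : IsLocalization.IsInteger R (l * q))
    (hlr' : IsLocalization.IsInteger R (l * r)⁻¹) (hlr0 : l * r ≠ 0) :
    ∃ κ ∈ hyperspecialSubgroup R (J3 u), ∃ a' b' c' d' e' f' : E,
      (((g * κ : formUnitaryGroup (J3 u)) : GL (Fin 3) E) : Matrix (Fin 3) (Fin 3) E) =
        !![a', b', c'; d', e', f'; 0, 0, r] := by
  have hr0 : r ≠ 0 := right_ne_zero_of_mul hlr0
  obtain ⟨hmem, a', b', c', d', e', f', hprod⟩ :=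
    exists_lower3_mul_eq u hsu hu0 (g : GL (Fin 3) E) g.2 a b c d e f p q r hg hr0
  -- the clearing data in terms of the scaled row
  have hsl : star l ≠ 0 := star_ne_zero.2 hl0
  have hsr : star r ≠ 0 := star_ne_zero.2 hr0
  have hy : star q / (u * star r) = star (l * q) / (u * star (l * r)) := by
    rw [star_mul, star_mul]; field_simp
  have hw : -(p + q * (star q / (u * star r))) / r =
      -(l * p + l * q * (star (l * q) / (u * star (l * r)))) / (l * r) := by
    rw [← hy]; field_simp; try ring
  -- integrality of the data, from the scaled row
  have hyint : IsLocalization.IsInteger R (star q / (u * star r)) := by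
    rw [hy, div_eq_mul_inv, mul_inv, ← mul_assoc]
    exact IsLocalization.isInteger_mul (IsLocalization.isInteger_mul (hstar _ hlq) hu')
      (isInteger_star_inv hstar hlr')
  have hwint : IsLocalization.IsInteger R (-(p + q * (star q / (u * star r))) / r) := by
    rw [hw, ← hy, div_eq_mul_inv]
    exact IsLocalization.isInteger_mul (isInteger_neg (IsLocalization.isInteger_add hlp
      (IsLocalization.isInteger_mul hlq hyint))) hlr'
  have husy : IsLocalization.IsInteger R (u * star (star q / (u * star r))) := by
    have hsy : star (star q / (u * star r)) = q / (u * r) := by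
      rw [star_div₀, star_star, star_mul, hsu, star_star, mul_comm]
    rw [hsy, show u * (q / (u * r)) = (l * q) * (l * r)⁻¹ by field_simp]
    exact IsLocalization.isInteger_mul hlq hlr'
  refine ⟨⟨lower3 u (star q / (u * star r)) (-(p + q * (star q / (u * star r))) / r), hmem⟩, ?_,
    a', b', c', d', e', f', ?_⟩
  · rw [mem_hyperspecialSubgroup_iff]
    exact lower3_mem_range hyint hwint husy
  · rw [Subgroup.coe_mul]
    exact hprod

include hstar hsu hu0 hu hu' hϖ in
/-- **Every `g ∈ U(J₃(u))` has a `K`-translate `g κ` with bottom row `(0, 0, r')`, `r' ≠ 0`.** -/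
theorem exists_mem_hyperspecial_coe_mul_eq (g : formUnitaryGroup (J3 u)) :
    ∃ κ ∈ hyperspecialSubgroup R (J3 u), ∃ a' b' c' d' e' f' r' : E, r' ≠ 0 ∧
      (((g * κ : formUnitaryGroup (J3 u)) : GL (Fin 3) E) : Matrix (Fin 3) (Fin 3) E) =
        !![a', b', c'; d', e', f'; 0, 0, r'] := by
  set M := ((g : GL (Fin 3) E) : Matrix (Fin 3) (Fin 3) E) with hM
  have hg : ((g : GL (Fin 3) E) : Matrix (Fin 3) (Fin 3) E) =
      !![M 0 0, M 0 1, M 0 2; M 1 0, M 1 1, M 1 2; M 2 0, M 2 1, M 2 2] := eq_fin_three M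
  have hrel := row_relations u hu0 (g : GL (Fin 3) E) _ _ _ _ _ _ _ _ _ hg g.2
  -- the bottom row is non-zero
  have hne : ¬ (M 2 0 = 0 ∧ M 2 1 = 0 ∧ M 2 2 = 0) := by
    rintro ⟨h0, h1, h2⟩
    have h7 := hrel.2.2.2.2.2.2.1
    rw [h0, h1, h2] at h7
    simp at h7
  obtain ⟨l, hl0, hlp, hlq, hlr, hprim⟩ := exists_scale_primitive hϖ (M 2 0) (M 2 1) (M 2 2) hne
  -- the scaled row is isotropic
  have hrel9 := hrel.2.2.2.2.2.2.2.2
  have hrel' : l * M 2 2 * star (l * M 2 0) + l * M 2 1 * u⁻¹ * star (l * M 2 1) + l * M 2 0 * star (l * M 2 2) = 0 := by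
    simp only [star_mul]
    linear_combination (l * star l) * hrel9
  rcases isUnit_fst_or_isUnit_last hstar u hu hϖ hu0 hlp hlr hrel' hprim with hp | hr
  · -- the unit is the first entry: swap by the Weyl element, then clear
    set W : formUnitaryGroup (J3 u) := ⟨T5CartanDominant.permUnit E Fin.revPerm, permUnit_rev3_mem u⟩ with hW
    have hgW : (((g * W : formUnitaryGroup (J3 u)) : GL (Fin 3) E) : Matrix (Fin 3) (Fin 3) E) =
        !![M 0 2, M 0 1, M 0 0; M 1 2, M 1 1, M 1 0; M 2 2, M 2 1, M 2 0] := by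
      rw [Subgroup.coe_mul]
      exact mul_permUnit_rev3 (g : GL (Fin 3) E) _ _ _ _ _ _ _ _ _ hg
    obtain ⟨κ', hκ', a', b', c', d', e', f', hprod⟩ := exists_mem_hyperspecial_of_unit_last hstar u hsu hu0 hu'
      (g * W) _ _ _ _ _ _ _ _ _ hgW hl0 hlr hlq hp.1 hp.2
    refine ⟨W * κ', Subgroup.mul_mem _ (permUnit_rev3_mem_hyperspecial u) hκ', a', b', c', d', e', f', M 2 0,
      right_ne_zero_of_mul hp.2, ?_⟩
    rw [← mul_assoc]
    exact hprod
  · obtain ⟨κ, hκ, a', b', c', d', e', f', hprod⟩ := exists_mem_hyperspecial_of_unit_last hstar u hsu hu0 hu'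
      g _ _ _ _ _ _ _ _ _ hg hl0 hlp hlq hr.1 hr.2
    exact ⟨κ, hκ, a', b', c', d', e', f', M 2 2, right_ne_zero_of_mul hr.2, hprod⟩

end Translate

end Summit.Ventures.HodgeRepro2.T5InertIwasawaPrimitive
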